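import Literature.Topology.FourManifolds.LadderSlideField
import Literature.Topology.FourManifolds.LevelSlabSlideStraightening
import Literature.Topology.FourManifolds.ClosedBallProofs
import Literature.Topology.FourManifolds.DiffeotopyProofs
import HarnessLib

/-!
# Straightening an embedded closed surface in the boundary of the ladder body across all pairs
# of bridges

Topic `Literature/Topology/FourManifolds`; brick E4a of the constructive road (P1′) to
`Literature.Topology.FourManifolds.Trisection.isConnectedSum_of_reducing_separating`
(`ReducibleTrisectionSplitting.lean`, § Status).  Let `Z = {G ≤ c} ⊂ ℝ⁴` be the ladder body
of `P : Ladder.Params k` and `∂Z = {G = c}` its boundary (`Bdry`, a compact `3`-manifold, the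
regular level manifold of `G`; `xN` its `x`-coordinate).  For a smooth embedding `f : Q ↪ ∂Z`
of a closed surface:

* §3 `exists_straighten_step`: one pair of bridges `i < k` — Sard gives a slab
  `[a - 3η₀, a + 3η₀]` of regular values of `x ∘ f` with `|a - slabCtr i| < 1/8`
  (`exists_slab_regularValues`); `IsRegularLevel.exists_levelUnitField` gives the unit field
  `U_Q` on `Q`; `Ladder.Params.exists_levelSlide` gives the level slide `U_N` on `∂Z` (flow `θ`
  of the slide field, half-width `1/4`); with `η = min (η₀, U_Q.δ/4, 1/16)` the straightening
  `SlideStraightening.exists_ambientIsotopy_straighten` yields an ambient isotopy `Ψ` of `∂Z`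
  with `Ψ_1 ∘ f` **straight** at slab `i` (`IsStraightAt`: the slab piece
  `(Ψ_1 ∘ f)(Q) ∩ {|x - a| ≤ 2η}` is the flow-out `{θ (r, ·)}` of its level `x = a`), `Ψ_t ∘ f = f`
  off `|x ∘ f - a| < 5η/2`, levels kept; the data are recorded as `SlabData`.
* §4 `exists_straighten`: induction over the slabs (the slab centres are `4` apart, the
  isotopy of slab `j` fixes `f` near every other slab, `SlabData.congr`): **a diffeomorphism
  `Φ` of `∂Z`, diffeotopic to the identity (`AmbientIsotopy.isDiffeotopicToId`,
  `IsDiffeotopicToId.trans`), keeping the `x`-levels of `f`, with slab data for `Φ ∘ f` at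
  every `i < k`.**

With `Ladder.Params.flow_eq_slideU` / `flow_eq_slideD` the flow-outs are the explicit slides
on the inner tubes.  Everything is **proved**; no named fact is introduced.

## References
* J. Milnor, *Morse theory* (1963), Thm. 3.1. [Milnor1963]
* M. W. Hirsch, *Differential Topology* (1976), Ch. 8 §1, Thm. 1.3. [HirschDT1976]
* J. Milnor, *Topology from the Differentiable Viewpoint* (1965), §3 (Sard, Brown). [MilnorTDV1965]
-/

noncomputable section

open scoped Topology ContDiff Manifold
open Set Filter Real

namespace Literature.Topology.FourManifolds

/-- Local notation: `𝔼 n` is the model Euclidean space `EuclideanSpace ℝ (Fin n)`. -/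
local notation "𝔼 " n:arg => EuclideanSpace ℝ (Fin n)

open Metric

namespace Ladder.Params

variable {k : ℕ} (P : Params k)

/-! ### §1 The boundary of the ladder body and its `x`-coordinate -/

/-- **The boundary `∂Z = {G = c}` of the ladder body**, as a regular level manifold (a compact
`3`-manifold without boundary in `ℝ⁴`). [folklore] -/
abbrev Bdry : Type := RegularLevel P.isRegularLevel_bodyG

/-- The boundary is compact. [folklore] -/
instance compactSpace_bdry : CompactSpace P.Bdry :=
  isCompact_iff_compactSpace.1
    (P.isHoledDiscMorseFunction.isCompact_preimage₄.of_isClosed_subset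
      (isClosed_singleton.preimage (contMDiff_iff_contDiff.1 P.isRegularLevel_bodyG.contMDiff).continuous)
      (fun p (hp : P.bodyG p = P.level) => (le_of_eq hp : P.bodyG p ≤ P.level)))

/-- The `x`-coordinate on the boundary. [folklore] -/
def xN (q : P.Bdry) : ℝ := RegularLevel.incl P.isRegularLevel_bodyG q 0

/-- The `x`-coordinate is smooth. [folklore] -/
theorem contMDiff_xN : ContMDiff (𝓡 3) 𝓘(ℝ, ℝ) ∞ P.xN :=
  ((contDiff_euclidean.1 contDiff_id 0 : ContDiff ℝ ∞ fun p : 𝔼 4 => p 0) |> contMDiff_iff_contDiff.2).comp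
    (RegularLevel.contMDiff_incl _)

/-- `xN` is `(fun p => p 0) ∘ incl` (definitional). [folklore] -/
theorem xN_eq : P.xN = (fun p : 𝔼 4 => p 0) ∘ RegularLevel.incl P.isRegularLevel_bodyG := rfl

/-! ### §2 Straightness of an embedded surface across a pair of bridges -/

section Straight

variable {Q : Type}

/-- **`F` is straight across slab data `(a, η)` with flow `θ`**: the slab piece
`F(Q) ∩ {|x - a| ≤ 2η}` (as a subset of `ℝ⁴`) is the flow-out
`{θ (r, F c) | x (F c) = a, |r| ≤ 2η}` of the level `F(Q) ∩ {x = a}`. [folklore] -/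
def IsStraightAt (F : Q → P.Bdry) (a η : ℝ) (θ : ℝ × 𝔼 4 → 𝔼 4) : Prop :=
  RegularLevel.incl P.isRegularLevel_bodyG '' (F '' {u | |P.xN (F u) - a| ≤ 2 * η}) =
    (fun p : Q × ℝ => θ (p.2, RegularLevel.incl P.isRegularLevel_bodyG (F p.1))) ''
      (((P.xN ∘ F) ⁻¹' {a}) ×ˢ Set.Icc (-(2 * η)) (2 * η))

/-- Straightness only depends on `F` over the slab `|x ∘ F - a| ≤ 2η` (and on `x ∘ F`). [folklore] -/
theorem IsStraightAt.congr {F F' : Q → P.Bdry} {a η : ℝ} {θ : ℝ × 𝔼 4 → 𝔼 4}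
    (hx : ∀ u, P.xN (F' u) = P.xN (F u)) (hF : ∀ u, |P.xN (F u) - a| ≤ 2 * η → F' u = F u)
    (h : P.IsStraightAt F a η θ) : P.IsStraightAt F' a η θ := by
  unfold IsStraightAt at h ⊢
  have hset : {u | |P.xN (F' u) - a| ≤ 2 * η} = {u | |P.xN (F u) - a| ≤ 2 * η} := by
    ext u; simp only [Set.mem_setOf_eq, hx]
  have hlev : (P.xN ∘ F') ⁻¹' {a} = (P.xN ∘ F) ⁻¹' {a} := by
    ext u; simp only [Set.mem_preimage, Function.comp_apply, hx]
  rw [hset, hlev]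
  have h1 : F' '' {u | |P.xN (F u) - a| ≤ 2 * η} = F '' {u | |P.xN (F u) - a| ≤ 2 * η} :=
    Set.image_congr fun u hu => hF u hu
  rw [h1, h]
  refine Set.image_congr fun p hp => ?_
  rw [hF p.1]
  have : (P.xN ∘ F) p.1 = a := hp.1
  simp only [Function.comp_apply] at this
  rw [this, sub_self, abs_zero]
  linarith [hp.2.1, hp.2.2]

end Straight

/-! ### §3 One slab: Sard, the unit field on the surface, the level slide, the straightening -/

section Step

variable {Q : Type} [TopologicalSpace Q] [T2Space Q] [CompactSpace Q] [ChartedSpace (𝔼 2) Q]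
  [IsManifold (𝓡 2) ∞ Q]

/-- The data recorded for a straightened slab: numerics of `(a, η)`, the regular slab of
`x ∘ F`, and the characterising properties of the flow `θ` of the slide field. [folklore] -/
structure SlabData (F : Q → P.Bdry) (i : ℕ) (a η : ℝ) (θ : ℝ × 𝔼 4 → 𝔼 4) : Prop where
  η_pos : 0 < η
  η_le : η ≤ 1 / 16
  abs_lt : |a - slabCtr i| < 1 / 8
  regular : ∀ u, P.xN (F u) ∈ Set.Icc (a - 3 * η) (a + 3 * η) → ¬ IsMCriticalPt (𝓡 2) (P.xN ∘ F) u
  contDiff : ContDiff ℝ ∞ θ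
  map_zero : ∀ x, θ (0, x) = x
  group : ∀ t s x, θ (t, θ (s, x)) = θ (t + s, x)
  hasDerivAt : ∀ x t, HasDerivAt (fun t => θ (t, x)) (P.slideField i (θ (t, x))) t
  straight : P.IsStraightAt F a η θ

omit [T2Space Q] [CompactSpace Q] [IsManifold (𝓡 2) ∞ Q] in
/-- Slab data only depend on `F` over the slab (and on `x ∘ F`). [folklore] -/
theorem SlabData.congr {F F' : Q → P.Bdry} {i : ℕ} {a η : ℝ} {θ : ℝ × 𝔼 4 → 𝔼 4}
    (hx : ∀ u, P.xN (F' u) = P.xN (F u)) (hF : ∀ u, |P.xN (F u) - a| ≤ 2 * η → F' u = F u)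
    (h : P.SlabData F i a η θ) : P.SlabData F' i a η θ where
  η_pos := h.η_pos
  η_le := h.η_le
  abs_lt := h.abs_lt
  regular := fun u hu => by
    have hxF : P.xN ∘ F' = P.xN ∘ F := funext fun u => hx u
    rw [hxF]; rw [hx] at hu; exact h.regular u hu
  contDiff := h.contDiff
  map_zero := h.map_zero
  group := h.group
  hasDerivAt := h.hasDerivAt
  straight := h.straight.congr P hx hF

/-- **Straightening across one pair of bridges.**  For a smooth embedding `F : Q ↪ ∂Z` of a
closed surface and `i < k` there are an ambient isotopy `Ψ` of `∂Z` and slab data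
`(a, η, θ)` for `Ψ_1 ∘ F` at slab `i`, with `Ψ_t ∘ F = F` off `|x ∘ F - a| < 5η/2` and
`x ∘ Ψ_t ∘ F = x ∘ F`. [cite: Milnor1963, Thm. 3.1; HirschDT1976, Ch. 8 §1, Thm. 1.3] -/
theorem exists_straighten_step {i : ℕ} (hi : i < k) (F : Q → P.Bdry)
    (hF : Manifold.IsSmoothEmbedding (𝓡 2) (𝓡 3) ∞ F) :
    ∃ (Ψ : AmbientIsotopy (𝓡 3) P.Bdry) (a η : ℝ) (θ : ℝ × 𝔼 4 → 𝔼 4),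
      P.SlabData (Ψ.toFun 1 ∘ F) i a η θ ∧
      (∀ t ∈ Set.Ioo (-1 / 2 : ℝ) (3 / 2), ∀ u, 5 / 2 * η ≤ |P.xN (F u) - a| → Ψ.toFun t (F u) = F u) ∧
      (∀ t ∈ Set.Ioo (-1 / 2 : ℝ) (3 / 2), ∀ u, P.xN (Ψ.toFun t (F u)) = P.xN (F u)) := by
  set σ : Q → ℝ := P.xN ∘ F with hσdef
  have hσ : ContMDiff (𝓡 2) 𝓘(ℝ, ℝ) ∞ σ := P.contMDiff_xN.comp hF.contMDiff
  -- Sard: a whole slab of regular values near the slab centre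
  obtain ⟨a, η₀, hη₀, hpa, haq, hreg⟩ := exists_slab_regularValues (m := 1) hσ
    (p := slabCtr i - 1 / 8) (q := slabCtr i + 1 / 8) (by linarith)
  have habs : |a - slabCtr i| < 1 / 8 := by rw [abs_lt]; constructor <;> linarith
  -- the unit field on `Q`
  have hlev : IsRegularLevel (𝓡 2) σ a := isRegularLevel_of_not_isMCriticalPt (k := 1) hσ
    fun u hu => hreg u (by rw [hu]; constructor <;> linarith)
  obtain ⟨U_Q⟩ := hlev.exists_levelUnitField
  -- the level slide on `∂Z`
  obtain ⟨θ, U_N, hθ, h0, hgrp, hint, -, hδ, hincl⟩ :=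
    P.exists_levelSlide hi (a := a) (δ := 1 / 4) (by norm_num) (by linarith [habs.le])
  -- the width
  set η : ℝ := min η₀ (min (U_Q.δ / 4) (1 / 16)) with hηdef
  have hη : 0 < η := by
    simp only [hηdef, lt_min_iff]; exact ⟨hη₀, by linarith [U_Q.δ_pos], by norm_num⟩
  have hηη₀ : η ≤ η₀ := min_le_left _ _
  have hηQ : 3 * η < U_Q.δ := by
    have : η ≤ U_Q.δ / 4 := (min_le_right _ _).trans (min_le_left _ _)
    linarith [U_Q.δ_pos]
  have hη16 : η ≤ 1 / 16 := (min_le_right _ _).trans (min_le_right _ _)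
  have hηN : 3 * η < U_N.δ := by rw [hδ]; linarith
  -- straighten
  have hUN : (U_N : LevelSlide 2 P.xN a) = U_N := rfl
  obtain ⟨Ψ, -, h1, hoff, hlevels⟩ :=
    SlideStraightening.exists_ambientIsotopy_straighten (f := F) (S := P.xN) U_Q U_N hηQ hηN hη hF
  refine ⟨Ψ, a, η, θ, ?_, hoff, hlevels⟩
  -- slab data for `Ψ_1 ∘ F`
  have hx1 : ∀ u, P.xN ((Ψ.toFun 1 ∘ F) u) = P.xN (F u) := fun u => hlevels 1 (by norm_num) u
  refine
    { η_pos := hη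
      η_le := hη16
      abs_lt := habs
      regular := fun u hu => ?_
      contDiff := hθ
      map_zero := h0
      group := hgrp
      hasDerivAt := hint
      straight := ?_ }
  · have hxF : P.xN ∘ (Ψ.toFun 1 ∘ F) = σ := funext fun u => hx1 u
    rw [hxF]
    rw [hx1] at hu
    exact hreg u ⟨by change a - 3 * η₀ ≤ P.xN (F u); linarith [hu.1], by change P.xN (F u) ≤ a + 3 * η₀; linarith [hu.2]⟩
  · -- the product description, pushed into `ℝ⁴`
    unfold IsStraightAt
    have hset : {u | |P.xN ((Ψ.toFun 1 ∘ F) u) - a| ≤ 2 * η} = {u | |P.xN (F u) - a| ≤ 2 * η} := by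
      ext u; simp only [Set.mem_setOf_eq, hx1]
    have hlev' : (P.xN ∘ (Ψ.toFun 1 ∘ F)) ⁻¹' {a} = (P.xN ∘ F) ⁻¹' {a} := by
      ext u
      simp only [Set.mem_preimage, Function.comp_apply, Set.mem_singleton_iff]
      rw [hlevels 1 (by norm_num) u]
    rw [hset, hlev']
    have hprod := SlideStraightening.image_slab_eq_product_of (f := F) (S := P.xN) U_Q hηQ hη U_N.fl
      (Φ := Ψ.toFun 1) h1
    rw [hprod, Set.image_image]
    refine Set.image_congr fun p hp => ?_
    have hpa : P.xN (F p.1) = a := hp.1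
    simp only [Function.comp_apply]
    rw [hincl]
    congr 2
    rw [h1 p.1 (by rw [hpa, sub_self, abs_zero]; linarith)]
    -- `drop` of a level point is the point, and the displacement is `0`
    have hband : p.1 ∈ U_Q.band := U_Q.mem_band_of_apply_eq hpa
    rw [show P.xN (F p.1) - a = 0 by rw [hpa, sub_self], U_Q.drop_of_apply_eq hpa, U_N.fl_zero]


/-! ### §4 All slabs: composing the straightenings -/

omit P in
/-- Distinct slab centres are at least `4` apart. [folklore] -/
theorem four_le_abs_slabCtr_sub {i j : ℕ} (hij : i ≠ j) : 4 ≤ |slabCtr i - slabCtr j| := by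
  unfold slabCtr
  rw [show (4 : ℝ) * i + 2 - (4 * j + 2) = 4 * ((i : ℝ) - j) by ring, abs_mul, abs_of_pos (by norm_num : (0:ℝ) < 4)]
  have : (1 : ℝ) ≤ |(i : ℝ) - j| := by
    rcases lt_or_gt_of_ne hij with h | h
    · have : (i : ℝ) + 1 ≤ j := by exact_mod_cast h
      rw [abs_of_neg (by linarith)]; linarith
    · have : (j : ℝ) + 1 ≤ i := by exact_mod_cast h
      rw [abs_of_pos (by linarith)]; linarith
  linarith

/-- **Straightening across the first `j` pairs of bridges** (induction on `j`): a diffeomorphism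
`Φ` of `∂Z` diffeotopic to the identity, keeping the `x`-levels of `f`, with slab data for
`Φ ∘ f` at every slab `i < j`. [cite: Milnor1963, Thm. 3.1; HirschDT1976, Ch. 8 §1, Thm. 1.3] -/
theorem exists_straighten_upTo (f : Q → P.Bdry) (hf : Manifold.IsSmoothEmbedding (𝓡 2) (𝓡 3) ∞ f) :
    ∀ j ≤ k, ∃ (Φ : P.Bdry ≃ₘ⟮𝓡 3, 𝓡 3⟯ P.Bdry) (a η : ℕ → ℝ) (θ : ℕ → ℝ × 𝔼 4 → 𝔼 4),
      Diffeomorph.IsDiffeotopicToId Φ ∧ (∀ u, P.xN (Φ (f u)) = P.xN (f u)) ∧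
      ∀ i < j, P.SlabData (⇑Φ ∘ f) i (a i) (η i) (θ i) := by
  intro j
  induction j with
  | zero =>
    intro _
    exact ⟨Diffeomorph.refl _ _ _, fun _ => 0, fun _ => 0, fun _ => fun p => p.2,
      Diffeomorph.isDiffeotopicToId_refl, fun _ => rfl, fun i hi => absurd hi (Nat.not_lt_zero i)⟩
  | succ j ih =>
    intro hj
    obtain ⟨Φ, a, η, θ, hΦ, hx, hdata⟩ := ih (Nat.le_of_succ_le hj)
    have hjk : j < k := hj
    have hF : Manifold.IsSmoothEmbedding (𝓡 2) (𝓡 3) ∞ (⇑Φ ∘ f) := hf.diffeomorph_comp Φ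
    obtain ⟨Ψ, a', η', θ', hdata', hoff, hlevels⟩ := P.exists_straighten_step hjk (⇑Φ ∘ f) hF
    refine ⟨Φ.trans (Ψ.toDiffeomorph 1), fun i => if i = j then a' else a i,
      fun i => if i = j then η' else η i, fun i => if i = j then θ' else θ i,
      hΦ.trans (Ψ.isDiffeotopicToId 1), fun u => ?_, fun i hi => ?_⟩
    · show P.xN (Ψ.toFun 1 (Φ (f u))) = P.xN (f u)
      rw [← hx u]; exact hlevels 1 (by norm_num) u
    · rcases Nat.lt_succ_iff_lt_or_eq.1 hi with hlt | rfl
      · -- an earlier slab: the new isotopy fixes `Φ ∘ f` there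
        simp only [hlt.ne, ↓reduceIte]
        refine (hdata i hlt).congr P (F := ⇑Φ ∘ f) (F' := ⇑(Φ.trans (Ψ.toDiffeomorph 1)) ∘ f)
          (fun u => hlevels 1 (by norm_num) u) (fun u hu => ?_)
        show Ψ.toFun 1 (Φ (f u)) = Φ (f u)
        refine hoff 1 (by norm_num) u ?_
        have h4 := four_le_abs_slabCtr_sub hlt.ne
        have hai := (hdata i hlt).abs_lt
        have haj := hdata'.abs_lt
        have hηi := (hdata i hlt).η_le
        have hηj := hdata'.η_le
        -- `|x - a'| ≥ |a' - a i| - |x - a i| ≥ 4 - 1/8 - 1/8 - 2/16`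
        have h1 : |slabCtr i - slabCtr j| ≤ |a i - slabCtr i| + |P.xN ((⇑Φ ∘ f) u) - a i| +
            |P.xN ((⇑Φ ∘ f) u) - a'| + |a' - slabCtr j| := by
          have e : slabCtr i - slabCtr j = -(a i - slabCtr i) - (P.xN ((⇑Φ ∘ f) u) - a i) +
            (P.xN ((⇑Φ ∘ f) u) - a') + (a' - slabCtr j) := by ring
          rw [e]
          refine (abs_add_le _ _).trans ?_
          refine add_le_add ((abs_add_le _ _).trans (add_le_add ((abs_sub _ _).trans ?_) le_rfl)) le_rfl
          rw [abs_neg]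
        linarith
      · simp only [↓reduceIte]
        exact hdata'

/-- **Straightening an embedded closed surface in `∂Z` across all `k` pairs of bridges.**  For a
smooth embedding `f : Q ↪ ∂Z` of a closed surface there is a diffeomorphism `Φ` of `∂Z`,
diffeotopic to the identity and keeping the `x`-levels of `f`, such that `Φ ∘ f` is straight
across every pair of bridges: for each `i < k` there are `a i` (within `1/8` of the slab
centre), `0 < η i ≤ 1/16` with `x ∘ f` regular over `[a i - 3η i, a i + 3η i]`, and the flow
`θ i` of the slide field of slab `i`, with
`(Φ ∘ f)(Q) ∩ {|x - a i| ≤ 2 η i} = {θ i (r, (Φ ∘ f) c) | x (f c) = a i, |r| ≤ 2 η i}`.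
[cite: Milnor1963, Thm. 3.1; HirschDT1976, Ch. 8 §1, Thm. 1.3] -/
theorem exists_straighten (f : Q → P.Bdry) (hf : Manifold.IsSmoothEmbedding (𝓡 2) (𝓡 3) ∞ f) :
    ∃ (Φ : P.Bdry ≃ₘ⟮𝓡 3, 𝓡 3⟯ P.Bdry) (a η : ℕ → ℝ) (θ : ℕ → ℝ × 𝔼 4 → 𝔼 4),
      Diffeomorph.IsDiffeotopicToId Φ ∧ (∀ u, P.xN (Φ (f u)) = P.xN (f u)) ∧
      ∀ i < k, P.SlabData (⇑Φ ∘ f) i (a i) (η i) (θ i) :=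
  P.exists_straighten_upTo f hf k le_rfl

end Step

end Ladder.Params

end Literature.Topology.FourManifolds
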